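import Literature.NumberTheory.Transcendental.PhilipponZeroEstimate
import Summits.ABC.StewartYu.MatveevLeverMatrix
import Mathlib.LinearAlgebra.FiniteDimensional.Lemmas
import Mathlib.LinearAlgebra.Matrix.Rank
import HarnessLib

/-!
# Nesterenko 2003, §5.2: the `ℓ₀` bookkeeping of Lemma 5.3 (linear algebra on `Lie G`)

Cell topic `Summits/ABC/StewartYu` (cell abc-stewartyu, seat p4); namespace
`Summit.ABC.StewartYu.ZeroEnd` (theorems only). First half of WP-M3.E (the END of the
zero-estimate argument, consumer of `Nesterenko2003_prop51`; sequel `NesterenkoZeroEnd.lean`).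
For the engine's subspace `𝔚 = {(η₀, η) ; b₁η₁ + ⋯ + bₙηₙ = 0} ⊂ Lie G = ℂ × ℂⁿ` (`b ∈ ℤⁿ ∖ 0`)
and an obstruction group `G* = 𝔙 × T_Φ` (`GaGm.ConnAlgSubgroup`) whose character lattice `Φ`
has a basis of `r` `ℤ`-independent rows `M`, the codimension
`ℓ₀ = dim 𝔚 − dim(𝔚 ∩ T_e(G*))` of Prop. 5.1 is computed:
`ℓ₀ + d₀ = r + [b ∉ span_ℚ Φ]` (`ell0_add_addDim_eq`; Nesterenko 2003, proofs of Lemmas 5.3/5.4,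
"ℓ₀ = r + 1 − d₀" resp. "ℓ₀ = r − d₀"). PROVED on the way:

* `finrank_prod_submodule` — `dim(p × q) = dim p + dim q`;
* `linearIndependent_rows_complex` — `ℤ`-independent integer rows are `ℂ`-independent (Gram
  determinant, `MatveevLever.det_mul_transpose_self_ne_zero`);
* `torusTangent_eq_ker`, `finrank_torusTangent` — `T_e(T_Φ) = ker M_ℂ`, `dim = n − r`, `r ≤ n`;
* `exists_int_relation_of_complex` — Cramer descent: an integer vector in the COMPLEX span of
  `ℤ`-independent integer rows satisfies `k b = ∑ cᵢ zᵢ` with `k ≠ 0`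
  (`MatveevLever.exists_cols_det_ne_zero` + `Matrix.cramer`);
* `ell0_add_addDim_eq` — the two cases `T_e(G*) ⊆ 𝔚` (⟺ `Φ^⊥ ⊆ b^⊥` ⟺ `b ∈ span_ℂ Φ` by rank
  ⟺ `b ∈ span_ℚ Φ` by the descent) and `T_e(G*) ⊄ 𝔚` (then `𝔚 + T_e(G*) = Lie G` since `𝔚` is
  a hyperplane), via `dim(𝔚 ⊔ T) + dim(𝔚 ⊓ T) = dim 𝔚 + dim T`.

WHAT THIS IS NOT: no zero estimate, no numerics, no linear forms.

## References

* [Nesterenko2003] Yu. V. Nesterenko, *Linear forms in logarithms of rational numbers*, LNM 1819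
  (2003), 53–106: §5.2, proofs of Lemmas 5.3 and 5.4, pp. 100–101.
-/

noncomputable section

namespace Summit.ABC.StewartYu.ZeroEnd

open Matrix Finset Module
open Literature.NumberTheory.Transcendental Literature.NumberTheory.Transcendental.GaGm

/-! ### Linear algebra for `ℓ₀` -/

/-- `dim (p × q) = dim p + dim q` for submodules of `ℂ` and `ℂⁿ`. [folklore] -/
theorem finrank_prod_submodule {n : ℕ} (p : Submodule ℂ ℂ) (q : Submodule ℂ (Fin n → ℂ)) :
    Module.finrank ℂ ↥(p.prod q) = Module.finrank ℂ p + Module.finrank ℂ q := by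
  let e : ↥(p.prod q) ≃ₗ[ℂ] (↥p × ↥q) :=
    { toFun := fun x => (⟨x.1.1, x.2.1⟩, ⟨x.1.2, x.2.2⟩)
      invFun := fun y => ⟨(y.1.1, y.2.1), ⟨y.1.2, y.2.2⟩⟩
      map_add' := fun x y => rfl
      map_smul' := fun c x => rfl
      left_inv := fun x => rfl
      right_inv := fun y => rfl }
  rw [LinearEquiv.finrank_eq e, Module.finrank_prod]

/-- Rows of an integer matrix that are `ℤ`-independent are `ℂ`-independent (Gram determinant).
[folklore] -/
theorem linearIndependent_rows_complex {r n : ℕ} (M : Matrix (Fin r) (Fin n) ℤ)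
    (hM : LinearIndependent ℤ (fun i => M i)) :
    LinearIndependent ℂ (fun i => (M.map (Int.castRingHom ℂ)) i) := by
  classical
  have hGram : (M * Mᵀ).det ≠ 0 := MatveevLever.det_mul_transpose_self_ne_zero M hM
  have hGramℂ : (M.map (Int.castRingHom ℂ) * (M.map (Int.castRingHom ℂ))ᵀ).det ≠ 0 := by
    rw [← Matrix.transpose_map, ← Matrix.map_mul, MatveevLever.det_map_castRingHom]
    exact_mod_cast hGram
  rw [Fintype.linearIndependent_iff]
  intro g hg
  have h1 : g ᵥ* M.map (Int.castRingHom ℂ) = 0 := by rw [Matrix.vecMul_eq_sum]; exact hg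
  have h2 : g ᵥ* (M.map (Int.castRingHom ℂ) * (M.map (Int.castRingHom ℂ))ᵀ) = 0 := by
    rw [← Matrix.vecMul_vecMul, h1, Matrix.zero_vecMul]
  exact congrFun (Matrix.eq_zero_of_vecMul_eq_zero hGramℂ h2)

/-- The torus tangent space of `G*` is the kernel of the (complexified) basis matrix of its
character lattice. [folklore] -/
theorem torusTangent_eq_ker {n r : ℕ} (H : ConnAlgSubgroup n) (M : Matrix (Fin r) (Fin n) ℤ)
    (hchars : H.chars = AddSubgroup.closure (Set.range fun i => M i)) :
    H.torusTangent = LinearMap.ker (M.map (Int.castRingHom ℂ)).mulVecLin := by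
  ext v
  rw [LinearMap.mem_ker, Matrix.mulVecLin_apply]
  change (∀ χ ∈ H.chars, ∑ j, (χ j : ℂ) * v j = 0) ↔ _
  rw [hchars]
  constructor
  · intro h
    funext i
    have hi := h (M i) (AddSubgroup.subset_closure ⟨i, rfl⟩)
    simpa [Matrix.mulVec, dotProduct] using hi
  · intro h χ hχ
    induction hχ using AddSubgroup.closure_induction with
    | mem x hx =>
        obtain ⟨i, rfl⟩ := hx
        have hi := congrFun h i
        simpa [Matrix.mulVec, dotProduct] using hi
    | zero => simp
    | add x y _ _ hx hy =>
        simp only [Pi.add_apply, Int.cast_add, add_mul, Finset.sum_add_distrib, hx, hy, add_zero]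
    | neg x _ hx =>
        simp only [Pi.neg_apply, Int.cast_neg, neg_mul, Finset.sum_neg_distrib, hx, neg_zero]

/-- `dim T_e(T_Φ) = n − r` for a character lattice with `r` independent rows, and `r ≤ n`.
[folklore] -/
theorem finrank_torusTangent {n r : ℕ} (H : ConnAlgSubgroup n) (M : Matrix (Fin r) (Fin n) ℤ)
    (hM : LinearIndependent ℤ (fun i => M i))
    (hchars : H.chars = AddSubgroup.closure (Set.range fun i => M i)) :
    Module.finrank ℂ H.torusTangent = n - r ∧ r ≤ n := by
  classical
  set Mc : Matrix (Fin r) (Fin n) ℂ := M.map (Int.castRingHom ℂ) with hMc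
  have hli := linearIndependent_rows_complex M hM
  have hrank : Mc.rank = r := by
    have h := finrank_span_eq_card hli
    rw [Fintype.card_fin] at h
    rw [Matrix.rank_eq_finrank_span_row]
    exact h
  have hrn : Module.finrank ℂ ↥(LinearMap.range Mc.mulVecLin) +
      Module.finrank ℂ ↥(LinearMap.ker Mc.mulVecLin) = n := by
    have h := LinearMap.finrank_range_add_finrank_ker Mc.mulVecLin
    rw [Module.finrank_fin_fun] at h
    exact h
  have hrange : Module.finrank ℂ ↥(LinearMap.range Mc.mulVecLin) = r := hrank
  rw [torusTangent_eq_ker H M hchars, ← hMc]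
  constructor <;> omega

/-- **Cramer descent**: an integer vector which is a COMPLEX combination of `ℤ`-independent integer
rows is a rational one: `k b = ∑ cᵢ zᵢ` with `k ≠ 0` (Cramer on a non-singular minor).
[cite: Nesterenko2003, proof of Prop 2.6 (2.9)–(2.10), p. 58] -/
theorem exists_int_relation_of_complex {r n : ℕ} (z : Fin r → (Fin n → ℤ))
    (hz : LinearIndependent ℤ z) (b : Fin n → ℤ) (q : Fin r → ℂ)
    (hb : ∀ j, (b j : ℂ) = ∑ i, q i * (z i j : ℂ)) :
    ∃ (k : ℤ) (c : Fin r → ℤ), k ≠ 0 ∧ k • b = ∑ i, c i • z i := by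
  classical
  obtain ⟨e, -, hdet⟩ := MatveevLever.exists_cols_det_ne_zero (Matrix.of z) hz
  set N : Matrix (Fin r) (Fin r) ℤ := Matrix.of fun i k => z i (e k) with hN
  have hNe : N = (Matrix.of z).submatrix id e := by ext i k; simp [hN]
  have hNdet : N.det ≠ 0 := by rw [hNe]; exact hdet
  set m : Fin r → ℤ := Matrix.cramer Nᵀ (fun k => b (e k)) with hm
  refine ⟨N.det, m, hNdet, ?_⟩
  -- integer Cramer identity on the selected columns
  have hcr : ∀ k, ∑ i, z i (e k) * m i = N.det * b (e k) := fun k => by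
    have h := congrFun (Matrix.mulVec_cramer Nᵀ (fun k => b (e k))) k
    rw [Matrix.det_transpose] at h
    simpa [Matrix.mulVec, dotProduct, Matrix.transpose_apply, hN, hm] using h
  -- over `ℂ` both `m` and `Δ q` solve the square system
  set Nc : Matrix (Fin r) (Fin r) ℂ := N.map (Int.castRingHom ℂ) with hNc
  have hNcTdet : Ncᵀ.det ≠ 0 := by
    rw [Matrix.det_transpose, hNc, MatveevLever.det_map_castRingHom]; exact_mod_cast hNdet
  have hmulVec : ∀ x : Fin r → ℂ, ∀ k, (Ncᵀ *ᵥ x) k = ∑ i, (z i (e k) : ℂ) * x i := fun x k => by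
    simp [Matrix.mulVec, dotProduct, hNc, hN, Matrix.transpose_apply, Matrix.map_apply]
  have hmq : ∀ i, (m i : ℂ) = (N.det : ℂ) * q i := by
    have h0 : Ncᵀ *ᵥ ((fun i => (m i : ℂ)) - fun i => (N.det : ℂ) * q i) = 0 := by
      rw [Matrix.mulVec_sub]
      funext k
      rw [Pi.sub_apply, hmulVec, hmulVec, Pi.zero_apply, sub_eq_zero]
      have h1 : ∑ i, (z i (e k) : ℂ) * (m i : ℂ) = (N.det : ℂ) * (b (e k) : ℂ) := by
        exact_mod_cast hcr k
      have h2 : ∑ i, (z i (e k) : ℂ) * ((N.det : ℂ) * q i) = (N.det : ℂ) * (b (e k) : ℂ) := by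
        rw [hb (e k), Finset.mul_sum]
        exact Finset.sum_congr rfl fun i _ => by ring
      rw [h1, h2]
    intro i
    have h := congrFun (Matrix.eq_zero_of_mulVec_eq_zero hNcTdet h0) i
    simpa [sub_eq_zero] using h
  funext j
  have hgoal : ((N.det : ℂ) * (b j : ℂ)) = ∑ i, (m i : ℂ) * (z i j : ℂ) := by
    rw [hb j, Finset.mul_sum]
    exact Finset.sum_congr rfl fun i _ => by rw [hmq i]; ring
  simp only [Pi.smul_apply, smul_eq_mul, Finset.sum_apply]
  exact_mod_cast hgoal

/-! ### Lemma 5.3's bookkeeping: `ℓ₀` -/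

/-- **`ℓ₀ + d₀ = r + [b ∉ span_ℚ Φ]`** for `𝔚 = ℂ × b^⊥` and `T_e(G*) = 𝔙 × Φ^⊥`, `Φ` with basis
the `r` rows of `M` (`ℓ₀ = dim 𝔚 − dim(𝔚 ∩ T_e(G*))`).
[cite: Nesterenko2003, §5.2 Lemma 5.3 (proof) and Lemma 5.4 (proof), pp. 100–101] -/
theorem ell0_add_addDim_eq {n : ℕ} (b : Fin n → ℤ) (hb : b ≠ 0)
    (W : Submodule ℂ (ℂ × (Fin n → ℂ))) (hW : ∀ w, w ∈ W ↔ ∑ j, (b j : ℂ) * w.2 j = 0)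
    (H : ConnAlgSubgroup n) {r : ℕ} (M : Matrix (Fin r) (Fin n) ℤ)
    (hM : LinearIndependent ℤ (fun i => M i))
    (hchars : H.chars = AddSubgroup.closure (Set.range fun i => M i)) :
    ((∃ (k : ℤ) (c : Fin r → ℤ), k ≠ 0 ∧ k • b = ∑ i, c i • M i) →
        Module.finrank ℂ W - Module.finrank ℂ ↥(W ⊓ H.tangent) + H.addDim = r) ∧
      ((¬ ∃ (k : ℤ) (c : Fin r → ℤ), k ≠ 0 ∧ k • b = ∑ i, c i • M i) →
        Module.finrank ℂ W - Module.finrank ℂ ↥(W ⊓ H.tangent) + H.addDim = r + 1) := by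
  classical
  -- `n ≥ 1`
  obtain ⟨j₀, hj₀⟩ : ∃ j, b j ≠ 0 := by
    by_contra h
    push Not at h
    exact hb (funext h)
  -- the functional `f_b` and `W = ℂ × ker f_b`
  set fb : (Fin n → ℂ) →ₗ[ℂ] ℂ := Fintype.linearCombination ℂ (fun j => (b j : ℂ)) with hfb
  have hfb_apply : ∀ v, fb v = ∑ j, (b j : ℂ) * v j := fun v => by
    rw [hfb, Fintype.linearCombination_apply]
    exact Finset.sum_congr rfl fun j _ => by rw [smul_eq_mul, mul_comm]
  have hWeq : W = (⊤ : Submodule ℂ ℂ).prod (LinearMap.ker fb) := by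
    ext w
    rw [hW, Submodule.mem_prod, LinearMap.mem_ker, hfb_apply]
    simp
  -- `dim ker f_b = n - 1`, `dim W = n`
  have hrange : LinearMap.range fb = ⊤ := by
    rw [eq_top_iff]
    intro c _
    refine ⟨(c / (b j₀ : ℂ)) • Pi.single j₀ (1 : ℂ), ?_⟩
    rw [map_smul, hfb_apply]
    rw [Finset.sum_eq_single j₀ (fun j _ hj => by simp [Pi.single_eq_of_ne hj]) (by simp)]
    have hb0 : (b j₀ : ℂ) ≠ 0 := by exact_mod_cast hj₀
    simp only [Pi.single_eq_same, mul_one, smul_eq_mul]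
    field_simp
  have hker : Module.finrank ℂ ↥(LinearMap.ker fb) = n - 1 := by
    have h := LinearMap.finrank_range_add_finrank_ker fb
    rw [hrange, finrank_top, Module.finrank_self, Module.finrank_fin_fun] at h
    omega
  have hn1 : 1 ≤ n := Nat.succ_le_of_lt (Fin.pos j₀)
  have hWdim : Module.finrank ℂ W = n := by
    rw [hWeq, finrank_prod_submodule, finrank_top, Module.finrank_self, hker]
    omega
  -- `T = 𝔙 × Φ^⊥`, `dim T = d₀ + (n - r)`
  set T : Submodule ℂ (ℂ × (Fin n → ℂ)) := H.tangent with hT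
  obtain ⟨htorus, hrn⟩ := finrank_torusTangent H M hM hchars
  have hTdim : Module.finrank ℂ T = H.addDim + (n - r) := by
    rw [hT, ConnAlgSubgroup.tangent, finrank_prod_submodule, htorus]
    congr 1
    cases hP : H.addPart
    · simp only [ConnAlgSubgroup.addDim, hP, Bool.false_eq_true, if_false]
      exact finrank_bot ℂ ℂ
    · simp only [ConnAlgSubgroup.addDim, hP, if_true]
      exact (finrank_top ℂ ℂ).trans (Module.finrank_self ℂ)
  have hVdim : Module.finrank ℂ (ℂ × (Fin n → ℂ)) = n + 1 := by
    rw [Module.finrank_prod, Module.finrank_self, Module.finrank_fin_fun, add_comm]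
  -- `T ≤ W ↔ Φ^⊥ ≤ ker f_b`
  have hTW : T ≤ W ↔ H.torusTangent ≤ LinearMap.ker fb := by
    rw [hWeq, hT, ConnAlgSubgroup.tangent]
    constructor
    · intro h v hv
      have h' := h (Submodule.mem_prod.mpr ⟨by split <;> simp, hv⟩ : ((0 : ℂ), v) ∈ _)
      exact (Submodule.mem_prod.mp h').2
    · intro h
      exact Submodule.prod_mono le_top h
  -- `Φ^⊥ ≤ ker f_b ↔ b ∈ span_ℚ Φ`
  have hiff : H.torusTangent ≤ LinearMap.ker fb ↔
      ∃ (k : ℤ) (c : Fin r → ℤ), k ≠ 0 ∧ k • b = ∑ i, c i • M i := by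
    rw [torusTangent_eq_ker H M hchars]
    constructor
    · intro h
      -- `ker [M; b] = ker M`, so `rank [M; b] = r`, so `b ∈ span_ℂ (rows M)`
      set Mc : Matrix (Fin r) (Fin n) ℂ := M.map (Int.castRingHom ℂ) with hMc
      have hli := linearIndependent_rows_complex M hM
      by_contra hnot
      have hbspan : (fun j => (b j : ℂ)) ∉ Submodule.span ℂ (Set.range fun i => Mc i) := by
        intro hmem
        obtain ⟨q, hq⟩ := Submodule.mem_span_range_iff_exists_fun ℂ |>.mp hmem
        apply hnot
        refine exists_int_relation_of_complex (fun i => M i) hM b q fun j => ?_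
        have h := congrFun hq j
        simp only [Finset.sum_apply, Pi.smul_apply, smul_eq_mul, hMc, Matrix.map_apply,
          eq_intCast] at h
        rw [← h]
      -- the augmented matrix
      set M' : Matrix (Fin (r + 1)) (Fin n) ℂ := Matrix.of (Fin.cons (fun j => (b j : ℂ)) (fun i => Mc i))
        with hM'
      have hli' : LinearIndependent ℂ (fun i => M' i) := by
        have : (fun i => M' i) = Fin.cons (fun j => (b j : ℂ)) (fun i => Mc i) := by
          funext i; rfl
        rw [this]
        exact (linearIndependent_finCons).mpr ⟨hli, hbspan⟩
      have hrank' : M'.rank = r + 1 := by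
        have h := finrank_span_eq_card hli'
        rw [Fintype.card_fin] at h
        rw [Matrix.rank_eq_finrank_span_row]
        exact h
      -- but `ker M' = ker Mc`, so `rank M' = rank Mc = r`
      have hker' : LinearMap.ker M'.mulVecLin = LinearMap.ker Mc.mulVecLin := by
        ext v
        simp only [LinearMap.mem_ker, Matrix.mulVecLin_apply]
        constructor
        · intro hv
          funext i
          have := congrFun hv (Fin.succ i)
          simpa [hM', Matrix.mulVec, dotProduct] using this
        · intro hv
          have hvb : fb v = 0 := h (by rw [LinearMap.mem_ker, Matrix.mulVecLin_apply]; exact hv)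
          funext i
          refine Fin.cases ?_ (fun i => ?_) i
          · rw [hfb_apply] at hvb
            simpa [hM', Matrix.mulVec, dotProduct] using hvb
          · have := congrFun hv i
            simpa [hM', Matrix.mulVec, dotProduct] using this
      have hrn' := LinearMap.finrank_range_add_finrank_ker M'.mulVecLin
      have hrn := LinearMap.finrank_range_add_finrank_ker Mc.mulVecLin
      rw [hker', Module.finrank_fin_fun] at hrn'
      rw [Module.finrank_fin_fun] at hrn
      have hrank : Mc.rank = r := by
        have h := finrank_span_eq_card hli
        rw [Fintype.card_fin] at h
        rw [Matrix.rank_eq_finrank_span_row]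
        exact h
      have h1 : Module.finrank ℂ ↥(LinearMap.range M'.mulVecLin) = r + 1 := hrank'
      have h2 : Module.finrank ℂ ↥(LinearMap.range Mc.mulVecLin) = r := hrank
      omega
    · rintro ⟨k, c, hk, hkb⟩ v hv
      rw [LinearMap.mem_ker, Matrix.mulVecLin_apply] at hv
      rw [LinearMap.mem_ker, hfb_apply]
      have hrow : ∀ i, ∑ j, (M i j : ℂ) * v j = 0 := fun i => by
        have := congrFun hv i
        simpa [Matrix.mulVec, dotProduct] using this
      have hkb' : ∀ j, (k : ℂ) * (b j : ℂ) = ∑ i, (c i : ℂ) * (M i j : ℂ) := fun j => by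
        have h := congrFun hkb j
        simp only [Pi.smul_apply, smul_eq_mul, Finset.sum_apply] at h
        exact_mod_cast h
      have hk0 : (k : ℂ) ≠ 0 := by exact_mod_cast hk
      have : (k : ℂ) * ∑ j, (b j : ℂ) * v j = 0 := by
        rw [Finset.mul_sum]
        calc ∑ j, (k : ℂ) * ((b j : ℂ) * v j) = ∑ j, ∑ i, (c i : ℂ) * (M i j : ℂ) * v j := by
              refine Finset.sum_congr rfl fun j _ => ?_
              rw [← mul_assoc, hkb', Finset.sum_mul]
          _ = ∑ i, (c i : ℂ) * ∑ j, (M i j : ℂ) * v j := by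
              rw [Finset.sum_comm]
              refine Finset.sum_congr rfl fun i _ => ?_
              rw [Finset.mul_sum]
              exact Finset.sum_congr rfl fun j _ => by ring
          _ = 0 := by simp [hrow]
      exact (mul_eq_zero.mp this).resolve_left hk0
  -- the two cases
  have hsupinf : Module.finrank ℂ ↥(W ⊔ T) + Module.finrank ℂ ↥(W ⊓ T) =
      Module.finrank ℂ W + Module.finrank ℂ T := Submodule.finrank_sup_add_finrank_inf_eq W T
  have hadd : H.addDim ≤ 1 := by
    cases hP : H.addPart <;> simp [ConnAlgSubgroup.addDim, hP]
  constructor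
  · intro hex
    have hle : T ≤ W := hTW.mpr (hiff.mpr hex)
    have hinf : W ⊓ T = T := inf_eq_right.mpr hle
    have hTle : Module.finrank ℂ T ≤ Module.finrank ℂ W := Submodule.finrank_mono hle
    rw [hinf, hTdim, hWdim]
    rw [hTdim, hWdim] at hTle
    omega
  · intro hnex
    have hnle : ¬ T ≤ W := fun h => hnex (hiff.mp (hTW.mp h))
    have hlt : W < W ⊔ T := left_lt_sup.mpr hnle
    have h1 : Module.finrank ℂ W < Module.finrank ℂ ↥(W ⊔ T) :=
      Submodule.finrank_lt_finrank_of_lt hlt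
    have h2 : Module.finrank ℂ ↥(W ⊔ T) ≤ n + 1 := by
      rw [← hVdim]; exact Submodule.finrank_le _
    have hTne : T ≠ ⊥ := by
      intro h0
      exact hnle (h0 ▸ bot_le)
    have hTpos : 0 < Module.finrank ℂ T := by
      rw [Nat.pos_iff_ne_zero, Ne, Submodule.finrank_eq_zero]
      exact hTne
    rw [hWdim, hTdim] at hsupinf
    rw [hWdim] at h1
    rw [hTdim] at hTpos
    rw [hWdim]
    have hsup' : Module.finrank ℂ ↥(W ⊔ T) = n + 1 := le_antisymm h2 h1
    rw [hsup'] at hsupinf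
    -- `finrank (W ⊓ T) + 1 = d₀ + (n - r)`
    set f := Module.finrank ℂ ↥(W ⊓ T) with hf
    clear_value f T fb
    clear hTW hiff hlt hnle hnex hWeq hfb_apply hrange h1 h2 hTne hT hfb hsup' hVdim hWdim hTdim htorus hker hf
    omega

end Summit.ABC.StewartYu.ZeroEnd

end
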